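/-
Copyright (c) 2026 the pub-hodgecm-mathlib formalisation cell (harness21).  Prover seat hodgecm-mathlib-LH5-p04 (g5): LH4-plan (g6) WORD #77 (P3e) «M1 LITERAL LAYER 5∕5»
(census `F0/P3c/LH5/LH5-p04/g5/p3e/CENSUS-P3e-organs-counts.v1.md` c74dfb9c83bd012d); 2026-09-02.
-/
import Literature.NumberTheory.Rogawski1990.FlickerTorusTraceFrame     -- ★ p851724 (LH4-p01 (g6)): the trace frame `Q_b`, the literals (T3) `t₁^{(b)}`, (T5) `t_π^{(b)}`, (T6) `valued_traceTorusElt_sub_one_le`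
import HarnessLib

/-!
# Depth of the `π`-twisted trace literal `t_π^{(b)} − 1` (any valued field) and the place-wise reading of the trace literals on the CM carrier —
# the ½-free twins of ★ `TwoDeepRepresentativesTypeOneOrgans` §2 (Flicker 1998 §6; Rogawski 1990 Prop. 4.9.1; Jacobowitz 1962 §7)

Topic `NumberTheory/Rogawski1990`; namespace `Literature.NumberTheory.Rogawski1990`.  THEOREMS ONLY (no definition, no instance, no notation, no named fact, no `sorry`);
count-neutral; kernel lane `--supports stmt-HodgeConjecture-24833`.  Cell `pub/hodgecm-mathlib` (D-0151), crux H413 = `stmt-HodgeConjecture-24833`, half A line LH4 (dyadic pay-down;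
(D-UNR) PRINT by ruling D74′), LEAD T13-42 (4) price list, LH4-plan (g6) WORD #77 (P3e) «M1 LITERAL LAYER 5∕5»: the valued-depth organ of ★ p846535
`TwoDeepRepresentativesTypeOneOrgans` §2 (`Flicker1998.valuation_flickerLiteralPi_sub_one_le (h2e : 2e = 1) (he : |e| ≤ 1)`) RE-KEYED on the trace frame of ★ p851724
(`b + σb = 1` in place of `e = ½`).  Its `θ̄ = 0` companion `valuation_flickerLiteralOne_sub_one_le` already has its twin ★ (T6) `valued_traceTorusElt_sub_one_le`; the support organ
§1 of ★ p846535 and §1–§2 of ★ `DepthZeroKappaTransferTypeOneCounts` are 2-free as they stand (cited, not twinned); §3 of the latter reads the count ENGINE and is excluded (census).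
HONEST READER LABEL: BANKED base layer for the re-based LIFT rider (★ `TwoDeepRepresentativesTypeOne`, row #14) — by LH4-p01 (g6)'s design (D) (★ `FlickerTraceFramePermutation`:
`g₃·t₁^{(b)}(a,m,c) = t_π^{(b)}(a,c,m)·g₃`, `g₄·t₁^{(b)}(a,m,c) = t_π^{(b)}(m,a,c)… `) the classes `τ₂, τ₃, τ₄` are ALL (T5) π-literals with permuted eigenvalues, so the ONE lemma
`valued_traceTorusEltPi_sub_one_le` below is the `hMD` input of the rider's transport step for all three (and ★ (T6) for `τ₁`); HC_CM is proved only modulo the 7 printed citations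
(2 remaining named inputs: hLiu418 = stmt-HodgeConjecture-24832, h413 = stmt-HodgeConjecture-24833) until rung 0 closes; pure valued commutative algebra, pays no organ, opens no road.

CONTENTS.
* §1 (any `CommRing R`, `σ : R →+* R`, `b + σb = 1`) `traceTorusEltPi_sub_one`: the entrywise identity
  `t_π^{(b)}(a,m,c) − 1 = ((a−1)σb + (c−1)b, 0, π(a − c); 0, m − 1, 0; π′·bσb(a − c), 0, (a−1)b + (c−1)σb)` for the ★ (T5) literal
  `t_π^{(b)}(a,m,c) = (aσb + cb, 0, π(a − c); 0, m, 0; π′·bσb(a − c), 0, ab + cσb)` (twin of ★ (T6) `traceTorusElt_sub_one`).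
* §2 (any field `K` with `Valued K Γ₀`) **`valued_traceTorusEltPi_sub_one_le`**: `|a − 1|, |m − 1|, |c − 1| ≤ D`, `|b|, |σb| ≤ 1`, `|π(a − c)| ≤ D`, `|π′(a − c)| ≤ D ⇒` every entry of
  `t_π^{(b)} − 1` has `|·| ≤ D` — NO `2e = 1`, NO `|e| ≤ 1` (contrast ★ `Flicker1998.valuation_flickerLiteralPi_sub_one_le`): the dyadic loss of Flicker's frame is gone; the
  `π′`-loss in the off-diagonal is genuine and stays as a hypothesis (with `π` a uniformizer, `|π′(a − c)| ≤ |ϖ|²` needs `a ≡ c (mod ϖ³)`: the «3-deep» caveat of ★ p846535 §2);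
  `valued_traceTorusEltPi_sub_one_le_of_valued_le_one`: the same with `|π| ≤ 1` in place of `|π(a − c)| ≤ D`.
* §3 `valued_mul_sub_le_of_sub_one_le`: the rider's inline supplier «deep eigenvalues ⇒ small twisted difference»: `|x − 1|, |y − 1| ≤ E`, `|π|·E ≤ D ⇒ |π(x − y)| ≤ D`
  (used at `D = |ϖ|²`, `E = |ϖ|³` for `π` and for `π′ = π⁻¹`, `|π′| = |ϖ|⁻¹`).
* §4 (CM carrier `E_v = ∏_{w ∣ v} L_w`) `map_evalRingHom_traceTorusElt`, `map_evalRingHom_traceTorusEltPi`: the ★ (T3)∕(T5) literals over `LocalRing L v` read at a place `w ∣ v`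
  entrywise (public twins of the rider's private `map_evalRingHom_flickerLiteral{One,Pi}`).

## References
* [Flicker1998UnitaryFL] Y. Z. Flicker, *Elementary proof of the fundamental lemma for a unitary group*, Canad. J. Math. 50 (1998), §2 Prop. 3 pp. 78–79 (`t₁`, `t_π`), §6 pp. 95–97
  (depth of the representatives).
* [Rogawski1990] J. D. Rogawski, *Automorphic Representations of Unitary Groups in Three Variables*, Ann. of Math. Stud. 123 (1990), §4.9 Prop. 4.9.1 (a)(b) pp. 54–55.
* [Jacobowitz1962] R. Jacobowitz, *Hermitian forms over local fields*, Amer. J. Math. 84 (1962), §7 Thm. 7.1 (the trace condition `b + b̄ = 1`).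
-/

set_option autoImplicit false

noncomputable section

open Matrix
open scoped MatrixGroups

namespace Literature.NumberTheory.Rogawski1990

open Literature.NumberTheory.Automorphic

/-! ## §1 The entrywise identity for `t_π^{(b)} − 1` -/

section Ring

variable {R : Type*} [CommRing R] (σ : R →+* R)

/-- **`t_π^{(b)}(a,m,c) − 1` entrywise**: `= ((a−1)σb + (c−1)b, 0, π(a − c); 0, m − 1, 0; π′·bσb(a − c), 0, (a−1)b + (c−1)σb)` (`b + σb = 1`) — twin of ★ (T6)
`traceTorusElt_sub_one` for the `π`-twisted literal ★ (T5). [cite: Flicker1998UnitaryFL, §6 p. 95] -/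
theorem traceTorusEltPi_sub_one {b : R} (hb : b + σ b = 1) (π π' a m c : R) :
    !![a * σ b + c * b, 0, π * (a - c); 0, m, 0; π' * (b * σ b * (a - c)), 0, a * b + c * σ b] - 1 =
      !![(a - 1) * σ b + (c - 1) * b, 0, π * (a - c); 0, m - 1, 0; π' * (b * σ b * (a - c)), 0, (a - 1) * b + (c - 1) * σ b] := by
  have hb' : σ b + b = 1 := by rw [add_comm]; exact hb
  ext i j
  fin_cases i <;> fin_cases j <;> simp <;> grind

end Ring

/-! ## §2 The depth of `t_π^{(b)} − 1` over a valued field (no `½`) -/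

section Valued

variable {K : Type*} [Field K] {Γ₀ : Type*} [LinearOrderedCommGroupWithZero Γ₀] [Valued K Γ₀] (σ : K →+* K)

/-- **DEPTH OF THE `π`-TWISTED TRACE LITERAL**: if `|a − 1|, |m − 1|, |c − 1| ≤ D`, `|b|, |σb| ≤ 1` (`b + σb = 1`) and the two twisted differences satisfy `|π(a − c)| ≤ D`,
`|π′(a − c)| ≤ D`, then every entry of `t_π^{(b)}(a,m,c) − 1` has valuation `≤ D` — the twin of ★ `Flicker1998.valuation_flickerLiteralPi_sub_one_le` WITHOUT `2e = 1` and WITHOUT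
`|e| ≤ 1` (at a dyadic place Flicker's literal loses `ord 2` levels through `e = ½`; the trace literal loses none).  Serves `τ₂ = t_π^{(b)}(a,m,c)` and, with permuted arguments,
`τ₃, τ₄` (★ `FlickerTraceFramePermutation.g{Three,Four}Trace_mul_traceTorusElt`). [cite: Flicker1998UnitaryFL, §6 pp. 95–97] [cite: Rogawski1990, §4.9 Prop. 4.9.1 (b) p. 55] -/
theorem valued_traceTorusEltPi_sub_one_le {b : K} (hb : b + σ b = 1) (hb1 : Valued.v b ≤ 1) (hσb1 : Valued.v (σ b) ≤ 1) {π π' a m c : K} {D : Γ₀}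
    (ha : Valued.v (a - 1) ≤ D) (hm : Valued.v (m - 1) ≤ D) (hc : Valued.v (c - 1) ≤ D)
    (hπ : Valued.v (π * (a - c)) ≤ D) (hπ' : Valued.v (π' * (a - c)) ≤ D) :
    ∀ i j, Valued.v ((!![a * σ b + c * b, 0, π * (a - c); 0, m, 0; π' * (b * σ b * (a - c)), 0, a * b + c * σ b] - (1 : Matrix (Fin 3) (Fin 3) K)) i j) ≤ D := by
  have h11 : Valued.v ((a - 1) * σ b + (c - 1) * b) ≤ D := by
    refine (Valuation.map_add _ _ _).trans (max_le ?_ ?_)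
    · rw [map_mul]; exact (mul_le_mul' ha hσb1).trans_eq (mul_one D)
    · rw [map_mul]; exact (mul_le_mul' hc hb1).trans_eq (mul_one D)
  have h33 : Valued.v ((a - 1) * b + (c - 1) * σ b) ≤ D := by
    refine (Valuation.map_add _ _ _).trans (max_le ?_ ?_)
    · rw [map_mul]; exact (mul_le_mul' ha hb1).trans_eq (mul_one D)
    · rw [map_mul]; exact (mul_le_mul' hc hσb1).trans_eq (mul_one D)
  have h31 : Valued.v (π' * (b * σ b * (a - c))) ≤ D := by
    rw [show π' * (b * σ b * (a - c)) = (b * σ b) * (π' * (a - c)) by ring, map_mul, map_mul]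
    calc Valued.v b * Valued.v (σ b) * Valued.v (π' * (a - c)) ≤ 1 * 1 * D := mul_le_mul' (mul_le_mul' hb1 hσb1) hπ'
      _ = D := by rw [one_mul, one_mul]
  have h0 : Valued.v (0 : K) ≤ D := by rw [map_zero]; exact zero_le
  rw [traceTorusEltPi_sub_one σ hb]
  intro i j
  fin_cases i <;> fin_cases j
  · exact h11
  · exact h0
  · exact hπ
  · exact h0
  · exact hm
  · exact h0
  · exact h31
  · exact h0
  · exact h33

/-- **DEPTH OF THE `π`-TWISTED TRACE LITERAL, `π` integral**: as `valued_traceTorusEltPi_sub_one_le` with `|π| ≤ 1` in place of `|π(a − c)| ≤ D` (`|a − c| ≤ D` is free from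
`|a − 1|, |c − 1| ≤ D`); only the `π′`-twisted difference `|π′(a − c)| ≤ D` remains a genuine hypothesis. [cite: Flicker1998UnitaryFL, §6 pp. 95–97] -/
theorem valued_traceTorusEltPi_sub_one_le_of_valued_le_one {b : K} (hb : b + σ b = 1) (hb1 : Valued.v b ≤ 1) (hσb1 : Valued.v (σ b) ≤ 1) {π π' a m c : K} {D : Γ₀}
    (ha : Valued.v (a - 1) ≤ D) (hm : Valued.v (m - 1) ≤ D) (hc : Valued.v (c - 1) ≤ D)
    (hπ1 : Valued.v π ≤ 1) (hπ' : Valued.v (π' * (a - c)) ≤ D) :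
    ∀ i j, Valued.v ((!![a * σ b + c * b, 0, π * (a - c); 0, m, 0; π' * (b * σ b * (a - c)), 0, a * b + c * σ b] - (1 : Matrix (Fin 3) (Fin 3) K)) i j) ≤ D := by
  have hac : Valued.v (a - c) ≤ D := by
    rw [show a - c = (a - 1) - (c - 1) by ring]
    exact (Valuation.map_sub _ _ _).trans (max_le ha hc)
  have hπ : Valued.v (π * (a - c)) ≤ D := by
    rw [map_mul]; exact (mul_le_mul' hπ1 hac).trans_eq (one_mul D)
  exact valued_traceTorusEltPi_sub_one_le σ hb hb1 hσb1 ha hm hc hπ hπ'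

/-! ## §3 Deep eigenvalues ⇒ small twisted differences (the rider's supplier) -/

omit σ in
/-- **DEEP EIGENVALUES ⇒ SMALL TWISTED DIFFERENCE**: `|x − 1|, |y − 1| ≤ E` and `|π|·E ≤ D` give `|π(x − y)| ≤ D` — the supplier of the two twisted-difference hypotheses of
`valued_traceTorusEltPi_sub_one_le` (at `D = |ϖ|²`: `E = |ϖ|³` serves both `π = ϖ` and `π′ = ϖ⁻¹`, `|π′|·|ϖ|³ = |ϖ|²`: eigen-data 3-deep, as in the ★ rider
`TwoDeepRepresentativesTypeOne`). [cite: Flicker1998UnitaryFL, §6 p. 97] -/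
theorem valued_mul_sub_le_of_sub_one_le {x y π : K} {E D : Γ₀} (hx : Valued.v (x - 1) ≤ E) (hy : Valued.v (y - 1) ≤ E) (hπ : Valued.v π * E ≤ D) :
    Valued.v (π * (x - y)) ≤ D := by
  have hxy : Valued.v (x - y) ≤ E := by
    rw [show x - y = (x - 1) - (y - 1) by ring]
    exact (Valuation.map_sub _ _ _).trans (max_le hx hy)
  rw [map_mul]
  exact (mul_le_mul' le_rfl hxy).trans hπ

end Valued

/-! ## §4 The trace literals on the CM carrier `E_v = ∏_{w ∣ v} L_w`, read at a place `w ∣ v` -/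

section CM

open NumberField IsDedekindDomain Literature.NumberTheory.Automorphic.UnitaryGroup

variable (L : Type) [Field L] [NumberField L] (v : HeightOneSpectrum (𝓞 ↥(maximalRealSubfield L))) (w : PlacesOver L v)

/-- **The (T3) trace literal `t₁^{(b)}(a,m,c)` over `E_v` read at `w ∣ v`**: entrywise evaluation (the `w`-component of `σb` is written as a separate coordinate `sb w`, so the
lemma is `rfl` entrywise and applies with `sb := conjLocal … b`). [cite: Flicker1998UnitaryFL, §2 Prop. 3 p. 78] -/
theorem map_evalRingHom_traceTorusElt (b sb a m c : LocalRing L v) :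
    (!![a * sb + c * b, 0, a - c; 0, m, 0; b * sb * (a - c), 0, a * b + c * sb] :
        Matrix (Fin 3) (Fin 3) (LocalRing L v)).map (Pi.evalRingHom (fun w' : PlacesOver L v => w'.1.adicCompletion L) w) =
      !![a w * sb w + c w * b w, 0, a w - c w; 0, m w, 0; b w * sb w * (a w - c w), 0, a w * b w + c w * sb w] :=
  Matrix.ext fun i j => by fin_cases i <;> fin_cases j <;> rfl

/-- **The (T5) `π`-twisted trace literal `t_π^{(b)}(a,m,c)` over `E_v` read at `w ∣ v`**: entrywise evaluation (`sb` = the coordinate of `σb`, `p, q` those of `π, π′`).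
[cite: Flicker1998UnitaryFL, §2 Prop. 3 p. 79] -/
theorem map_evalRingHom_traceTorusEltPi (b sb p q a m c : LocalRing L v) :
    (!![a * sb + c * b, 0, p * (a - c); 0, m, 0; q * (b * sb * (a - c)), 0, a * b + c * sb] :
        Matrix (Fin 3) (Fin 3) (LocalRing L v)).map (Pi.evalRingHom (fun w' : PlacesOver L v => w'.1.adicCompletion L) w) =
      !![a w * sb w + c w * b w, 0, p w * (a w - c w); 0, m w, 0; q w * (b w * sb w * (a w - c w)), 0, a w * b w + c w * sb w] :=
  Matrix.ext fun i j => by fin_cases i <;> fin_cases j <;> rfl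

end CM

end Literature.NumberTheory.Rogawski1990

end
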